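import Summits.Ventures.PercRepro.Night2LocalD2R14SixZeroH

/-!
# PercRepro — the six-element columns of R1₄ without a far preimage, part I: the cell `κ = 1` (night-2, gen 16)

With `z` the only coloop of `S` besides `y` (`|S| = 6`, no far preimage): at most one covering preimage (`S ∖ {z}`),
at most six pair preimages (the 2-subsets of `S ∖ {y, z}`), `t ≤ 4` of them of `|G ∖ cl B| = 3` when `|G ∖ S| ≥ 3`
(`mul_card_three_le`), and the pair part plus the `p₅`-part of the spread is at most `t·(2/25) + (p − t)·(2/75)`
(`sum_r14Pair_add_le`).  Hence

**`sum_r14W_col_le_of_card_six_of_one_coloop`**: the column is `≤ 523/525` (with the identity preimage) or `≤ 6/7`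
(without), and **`shadowHall_six_four_of_six_columns_noColoop`**: THE (6,4) SHADOW ROW FOR EVERY FINITE MATROID modulo
the six-element columns without a far preimage and WITHOUT ANY COLOOP OF `S` BESIDES `y` (the cell `κ = 0`,
proofs/NIGHT-2-k1.md §7.3–7.4).
-/

namespace PercRepro.Shadow

open Finset PerFlat ThmH

variable {α : Type*} [DecidableEq α] {M : Matroid α} [M.Finite]

open scoped Classical in
/-- With `z` the only coloop of `S` besides `y`, every covering preimage of `|G ∖ cl B| ≥ 2` is `S ∖ {z}`. -/
theorem card_r14CovPre_le_one_of_one_coloop {G : Finset α} (hG : G ∈ flatsQ M (4 + 1)) {y : α} (hyG : y ∈ G)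
    (hyc : y ∉ clF M (G.erase y)) {S : Finset α} {z : α}
    (hone : ∀ z' ∈ S, z' ≠ y → z' ∉ clF M (S.erase z') → z' = z) : (r14CovPre M G S).card ≤ 1 := by
  rw [Finset.card_le_one]
  intro B hB B' hB'
  obtain ⟨z₁, hz₁S, hz₁y, rfl, hz₁, -⟩ := exists_coloop_of_mem_r14CovPre hG hyG hyc hB
  obtain ⟨z₂, hz₂S, hz₂y, rfl, hz₂, -⟩ := exists_coloop_of_mem_r14CovPre hG hyG hyc hB'
  rw [hone z₁ hz₁S hz₁y hz₁, hone z₂ hz₂S hz₂y hz₂]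

open scoped Classical in
/-- With a coloop `z` of `S` besides `y` at `|S| = 6`, at most six pair preimages. -/
theorem card_pairPre_le_six_of_coloop {G : Finset α} (hG : G ∈ flatsQ M (4 + 1)) {y : α} (hyG : y ∈ G)
    (hyc : y ∉ clF M (G.erase y)) {S : Finset α} (hS : S ∈ shadowAt M (4 + 2) 4 (Uq M (4 + 2) 4) G)
    (h6 : S.card = 6) {z : α} (hzS : z ∈ S) (hzy : z ≠ y) (hz : z ∉ clF M (S.erase z)) :
    (pairPre M 4 G S).card ≤ 6 := by
  have hyS : y ∈ S := mem_of_mem_shadowAt_of_coloop (by rw [rkN_erase_eq_of_coloop hG hyG hyc]) hS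
  have hmaps : ∀ B ∈ pairPre M 4 G S, S \ B ∈ Finset.powersetCard 2 (S \ {y, z}) := by
    intro B hB
    rw [Finset.mem_powersetCard]
    refine ⟨?_, card_sdiff_of_mem_pairPre hB⟩
    intro e he
    rw [Finset.mem_sdiff, Finset.mem_insert, Finset.mem_singleton, not_or]
    exact ⟨(Finset.mem_sdiff.1 he).1, fun h => (Finset.mem_sdiff.1 he).2 (h ▸ mem_of_mem_pairPre hG hyG hyc hB),
      fun h => notMem_sdiff_of_mem_pairPre_of_coloop' hG hS hzS hz hB (h ▸ he)⟩
  have hinj : Set.InjOn (fun B => S \ B) (pairPre M 4 G S : Set (Finset α)) := by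
    intro B hB B' hB' h
    by_contra hne
    exact sdiff_ne_of_mem_pairPre (Finset.mem_coe.1 hB) (Finset.mem_coe.1 hB') hne h
  have h1 := Finset.card_le_card_of_injOn (fun B => S \ B) hmaps hinj
  have hc : (S \ {y, z}).card = 4 := by
    have := Finset.card_sdiff_add_card_eq_card (show ({y, z} : Finset α) ⊆ S from
      Finset.insert_subset hyS (Finset.singleton_subset_iff.2 hzS))
    rw [Finset.card_pair hzy.symm] at this
    omega
  rw [Finset.card_powersetCard, hc] at h1
  have h42 : Nat.choose 4 2 = 6 := by decide
  omega

open scoped Classical in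
/-- **The pair part plus the `p₅`-part of the spread**: without a far preimage,
`Σ r14Pair + c·p₅ ≤ t·(2/25) + (p − t)·(2/75)` for `0 ≤ c ≤ 2/75`, where `t` counts the pair preimages of
`|G ∖ cl B| = 3` and `p₅` those of `|G ∖ cl B| ≥ 5`. -/
theorem sum_r14Pair_add_le {G S : Finset α} (hf : opFarPre M G S = ∅) {c : ℚ} (hc : c ≤ 2 / 75) :
    ∑ B ∈ pairPre M 4 G S, r14Pair M G B +
      c * (((pairPre M 4 G S).filter (fun B => 5 ≤ (G \ clF M B).card)).card : ℚ) ≤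
    (((pairPre M 4 G S).filter (fun B => (G \ clF M B).card = 3)).card : ℚ) * (2 / 25) +
      (((pairPre M 4 G S).card : ℚ) - (((pairPre M 4 G S).filter (fun B => (G \ clF M B).card = 3)).card : ℚ)) *
        (2 / 75) := by
  -- termwise: `r14Pair B + c·[5 ≤ m] ≤ if m = 3 then 2/25 else 2/75`
  have hterm : ∀ B ∈ pairPre M 4 G S, r14Pair M G B + (if 5 ≤ (G \ clF M B).card then c else 0) ≤
      (if (G \ clF M B).card = 3 then (2 : ℚ) / 25 else 2 / 75) := by
    intro B hB
    have h3 := three_le_card_sdiff_clF_of_noFar hf hB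
    by_cases hm3 : (G \ clF M B).card = 3
    · rw [if_pos hm3, if_neg (by omega)]
      have := r14Pair_le_of_three_le h3
      linarith
    · rw [if_neg hm3]
      by_cases hm5 : 5 ≤ (G \ clF M B).card
      · rw [if_pos hm5]
        have : r14Pair M G B = 0 := by
          unfold r14Pair
          rw [if_neg (by omega)]
        linarith
      · rw [if_neg hm5]
        have := r14Pair_le_of_four_le (M := M) (G := G) (B := B) (by omega)
        linarith
  have hsum : ∑ B ∈ pairPre M 4 G S, (r14Pair M G B + (if 5 ≤ (G \ clF M B).card then c else 0)) ≤
      ∑ B ∈ pairPre M 4 G S, (if (G \ clF M B).card = 3 then (2 : ℚ) / 25 else 2 / 75) := Finset.sum_le_sum hterm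
  rw [Finset.sum_add_distrib, ← Finset.sum_filter, Finset.sum_const, nsmul_eq_mul, mul_comm] at hsum
  have hrhs : ∑ B ∈ pairPre M 4 G S, (if (G \ clF M B).card = 3 then (2 : ℚ) / 25 else 2 / 75) =
      (((pairPre M 4 G S).filter (fun B => (G \ clF M B).card = 3)).card : ℚ) * (2 / 25) +
      (((pairPre M 4 G S).card : ℚ) - (((pairPre M 4 G S).filter (fun B => (G \ clF M B).card = 3)).card : ℚ)) *
        (2 / 75) := by
    rw [Finset.sum_ite, Finset.sum_const, Finset.sum_const, nsmul_eq_mul, nsmul_eq_mul]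
    have := Finset.card_filter_add_card_filter_not (s := pairPre M 4 G S) (p := fun B => (G \ clF M B).card = 3)
    have hq : (((pairPre M 4 G S).filter (fun B => ¬ (G \ clF M B).card = 3)).card : ℚ) =
        ((pairPre M 4 G S).card : ℚ) - (((pairPre M 4 G S).filter (fun B => (G \ clF M B).card = 3)).card : ℚ) := by
      have h' : (((pairPre M 4 G S).filter (fun B => (G \ clF M B).card = 3)).card : ℚ) +
          (((pairPre M 4 G S).filter (fun B => ¬ (G \ clF M B).card = 3)).card : ℚ) =
          ((pairPre M 4 G S).card : ℚ) := by exact_mod_cast this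
      linarith
    rw [hq]
  rw [hrhs] at hsum
  linarith

open scoped Classical in
/-- **The column of R1₄ at a six-element shadow set without a far preimage and with exactly one coloop `z` of `S`
besides `y` is `≤ 1`** (`≤ 523/525`). -/
theorem sum_r14W_col_le_of_card_six_of_one_coloop {G : Finset α} (hG : G ∈ flatsQ M (4 + 1))
    (hd : (gr M \ G).card = 2) (hsimple : ∀ e ∈ gr M, ∀ f ∈ gr M, e ≠ f → rkN M {e, f} = 2) {y : α}
    (hyG : y ∈ G) (hyc : y ∉ clF M (G.erase y)) (hP : ∀ z ∈ G.erase y, 4 ≤ rkN M ((G.erase y).erase z))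
    {S : Finset α} (hS : S ∈ shadowAt M (4 + 2) 4 (Uq M (4 + 2) 4) G) (h6 : S.card = 6)
    (hf : opFarPre M G S = ∅) {z : α} (hzS : z ∈ S) (hzy : z ≠ y) (hz : z ∉ clF M (S.erase z))
    (hone : ∀ z' ∈ S, z' ≠ y → z' ∉ clF M (S.erase z') → z' = z) :
    ∑ B ∈ membersIn M (Uq M (4 + 2) 4) G, r14W M G B S ≤ 1 := by
  have hparts := sum_r14W_col_le_parts (M := M) G S
  rw [r14KeepPre_eq_empty (by omega), Finset.sum_empty, r14PairPre_eq_pairPre] at hparts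
  set q : ℚ := ((G \ S).card : ℚ) with hqdef
  have hq0 : (0 : ℚ) ≤ q := Nat.cast_nonneg _
  have hq1 : (0 : ℚ) < q + 1 := by positivity
  -- the covering part
  have hcov : ∑ B ∈ r14CovPre M G S, r14Cov M G B ≤ 6 / 35 := by
    have h1 : ∑ B ∈ r14CovPre M G S, r14Cov M G B ≤ ((r14CovPre M G S).card : ℚ) * (6 / 35) := by
      rw [← nsmul_eq_mul, ← Finset.sum_const]
      exact Finset.sum_le_sum (fun B _ => r14Cov_le G B)
    have h2 : ((r14CovPre M G S).card : ℚ) ≤ 1 := by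
      exact_mod_cast card_r14CovPre_le_one_of_one_coloop hG hyG hyc hone
    nlinarith
  -- the counts
  set p := (pairPre M 4 G S).card with hpdef
  set t := ((pairPre M 4 G S).filter (fun B => (G \ clF M B).card = 3)).card with htdef
  set p₅ := ((pairPre M 4 G S).filter (fun B => 5 ≤ (G \ clF M B).card)).card with hp₅def
  have hp6 : p ≤ 6 := card_pairPre_le_six_of_coloop hG hyG hyc hS h6 hzS hzy hz
  have htp : t ≤ p := Finset.card_le_card (Finset.filter_subset _ _)
  have ht3 := mul_card_three_le hG hsimple hyG hyc hS h6 hzS hzy hz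
  rw [← htdef] at ht3
  -- the spread
  have hspread := r14Spread_le_of_one_coloop hG hyG hyc hP hS h6 hzS hzy hz hone
  rw [← hp₅def, ← hqdef] at hspread
  -- the pair part with the `p₅`-share of the spread
  have hc' : (4 / 175 : ℚ) / (q + 1) ≤ 2 / 75 := by
    rw [div_le_iff₀ hq1]
    nlinarith
  have hpair := sum_r14Pair_add_le (M := M) (G := G) (S := S) hf hc'
  rw [← hp₅def, ← htdef, ← hpdef] at hpair
  have hι := card_r14IdPre_le_one hG hyG hyc hP hS
  -- the spread without the `p₅`-share
  have hsp : r14Spread M G S ≤ (36 / 175) / (q + 1) + (4 / 175) / (q + 1) * (p₅ : ℚ) := by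
    have : (4 / 25 + 8 / 175 + (4 / 175) * (p₅ : ℚ)) / (q + 1) = (36 / 175) / (q + 1) + (4 / 175) / (q + 1) * (p₅ : ℚ) := by
      field_simp
      ring
    linarith
  have hpq : (p : ℚ) ≤ 6 := by exact_mod_cast hp6
  have htpq : (t : ℚ) ≤ (p : ℚ) := by exact_mod_cast htp
  have ht0 : (0 : ℚ) ≤ (t : ℚ) := Nat.cast_nonneg _
  rcases Nat.eq_zero_or_pos (r14IdPre M G S).card with h0 | hpos
  · -- no identity preimage: `6/35 + 12/25 + 36/175 = 6/7`
    rw [h0] at hparts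
    simp only [Nat.cast_zero, zero_mul, zero_add] at hparts
    have h36 : (36 / 175 : ℚ) / (q + 1) ≤ 36 / 175 := by
      rw [div_le_iff₀ hq1]
      nlinarith
    have hpairs : ∑ B ∈ pairPre M 4 G S, r14Pair M G B + (4 / 175) / (q + 1) * (p₅ : ℚ) ≤ 12 / 25 := by
      have : (t : ℚ) * (2 / 25) + ((p : ℚ) - (t : ℚ)) * (2 / 75) ≤ 12 / 25 := by nlinarith
      linarith
    linarith
  · -- an identity preimage: `|G ∖ S| ≥ 3`, `t ≤ 4`
    obtain ⟨B, hB⟩ := Finset.card_pos.1 hpos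
    have hq3 := three_le_card_sdiff_of_idPre hG hd hyG hyc hP hS hB
    have ht4 : t ≤ 4 := by
      by_contra h
      push Not at h
      -- `t ≥ 5`: `5(q − 1) ≤ t(q − 1) ≤ 3q` gives `q ≤ 2`
      have h1 : 5 * ((G \ S).card - 1) ≤ t * ((G \ S).card - 1) := Nat.mul_le_mul_right _ (by omega)
      have h2 : 5 * ((G \ S).card - 1) ≤ 3 * (G \ S).card := le_trans h1 ht3
      omega
    have hq3' : (3 : ℚ) ≤ q := by rw [hqdef]; exact_mod_cast hq3
    have ht4' : (t : ℚ) ≤ 4 := by exact_mod_cast ht4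
    have h36 : (36 / 175 : ℚ) / (q + 1) ≤ 9 / 175 := by
      rw [div_le_iff₀ hq1]
      nlinarith
    have hpairs : ∑ B ∈ pairPre M 4 G S, r14Pair M G B + (4 / 175) / (q + 1) * (p₅ : ℚ) ≤ 28 / 75 := by
      have : (t : ℚ) * (2 / 25) + ((p : ℚ) - (t : ℚ)) * (2 / 75) ≤ 28 / 75 := by nlinarith
      linarith
    have hι' : ((r14IdPre M G S).card : ℚ) ≤ 1 := by exact_mod_cast hι
    nlinarith

open scoped Classical in
/-- (LI_G) in Case A modulo the six-element columns without a far preimage and without a coloop of `S` besides `y`. -/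
theorem localShadowHall_caseA_of_six_columns_noColoop {G : Finset α} (hG : G ∈ flatsQ M (4 + 1))
    (hd : (gr M \ G).card = 2) (hsimple : ∀ e ∈ gr M, ∀ f ∈ gr M, e ≠ f → rkN M {e, f} = 2)
    (hk : kColoops M G = 1) {y : α} (hyG : y ∈ G) (hyc : y ∉ clF M (G.erase y))
    (hcol6 : ∀ S ∈ shadowAt M (4 + 2) 4 (Uq M (4 + 2) 4) G, S.card = 6 → opFarPre M G S = ∅ →
      (∀ z ∈ S, z ≠ y → z ∈ clF M (S.erase z)) →
      ∑ B ∈ membersIn M (Uq M (4 + 2) 4) G, r14W M G B S ≤ 1) :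
    LocalShadowHall M 4 G := by
  have hP := four_le_rkN_erase_erase_of_kColoops_eq_one hG hk hyG hyc
  apply localShadowHall_caseA_of_six_columns_leOneColoop hG hd hsimple hk hyG hyc
  intro S hS h6 hf hone
  by_cases hno : ∀ z ∈ S, z ≠ y → z ∈ clF M (S.erase z)
  · exact hcol6 S hS h6 hf hno
  · push Not at hno
    obtain ⟨z, hzS, hzy, hz⟩ := hno
    exact sum_r14W_col_le_of_card_six_of_one_coloop hG hd hsimple hyG hyc hP hS h6 hf hzS hzy hz
      (fun z' hz'S hz'y hz' => hone z' hz'S z hzS hz'y hzy hz' hz)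

section SixFour

variable {α' : Type} [DecidableEq α']

/-- **THE `(6, 4)` SHADOW ROW FOR EVERY FINITE MATROID, MODULO THE SIX-ELEMENT COLUMNS OF R1₄ WITHOUT A FAR
PREIMAGE AND WITHOUT A COLOOP OF `S` BESIDES `y`** (the cell `κ = 0`: `S ∖ {y}` a five-point circuit;
proofs/NIGHT-2-k1.md §7.3–7.4). -/
theorem shadowHall_six_four_of_six_columns_noColoop
    (hsix : ∀ (N : Matroid α') [N.Finite], (∀ e ∈ gr N, ∀ f ∈ gr N, e ≠ f → rkN N {e, f} = 2) →
      (∀ e ∈ gr N, N.Indep {e}) → N.eRank = ((6 : ℕ) : ℕ∞) →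
      ∀ G ∈ flatsQ N (4 + 1), (gr N \ G).card = 2 → kColoops N G = 1 →
      ∀ y ∈ G, y ∉ clF N (G.erase y) → 6 ≤ rkN N ((gr N).erase y) →
      ∀ S ∈ shadowAt N (4 + 2) 4 (Uq N (4 + 2) 4) G, S.card = 6 → opFarPre N G S = ∅ →
      (∀ z ∈ S, z ≠ y → z ∈ clF N (S.erase z)) →
        ∑ B ∈ membersIn N (Uq N (4 + 2) 4) G, r14W N G B S ≤ 1)
    (M : Matroid α') [M.Finite] : ShadowHall M 6 4 (phiK 6 4) := by
  apply shadowHall_six_four_of_local_caseA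
  intro N _ hs hl hr G hG hd hk y hyG hyc hr6
  exact localShadowHall_caseA_of_six_columns_noColoop hG hd hs hk hyG hyc (hsix N hs hl hr G hG hd hk y hyG hyc hr6)

end SixFour

end PercRepro.Shadow
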